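import Summits.AtomisticToContinuum.Crystallization.Theorems.ExcessDecayLiouvilleFluxPairingFar
import Summits.AtomisticToContinuum.Crystallization.Theorems.ExcessDecayLiouvilleCaccioppoliTailWeightedBound
import Summits.AtomisticToContinuum.Crystallization.Theorems.ExcessDecayLiouvilleCaccioppoliLocal

/-!
# Route `ExcessDecayLiouville`: the work of flux rows against a cut-off field (nonlinear Caccioppoli, I)

Harmonic-replacement architecture for item `ExcessDecay` (stmt-AtomisticToContinuum-9334), nonlinear half.
Level-1 Caccioppoli for a field `f` whose operator rows on a ball are a forcing plus an antisymmetric flux,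
`(L f)(p) = φ p + Σ_{q ∈ SR, q ≠ p} Φ p q`: the work term `Σ' η² ⟪L f, f⟫` of the cut-off identity is the
forcing work plus the flux paired with the differences of the test field `W = η² f`,

* `work_flux_le` : `Σ'_p η_p² ⟪(L f)(p), f p⟫ ≤ Σ_p η_p² ‖φ p‖‖f p‖ + ½ ΣΣ ‖Φ p q‖ ‖W p − W q‖`;
* `nnForm_sqCutoff_le` : `nnForm(η² f) ≤ 2 nnForm(η f) + (C/d²) · 𝐌[f, R]` for a cut-off of Lipschitz
  constant `1/d` supported in `B_R(c₀)` (`W − V` bookkeeping with `V = η f`).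

All `[folklore]`; helper lemmas, nothing here closes an item.
-/

noncomputable section

namespace Summit.AtomisticToContinuum.Crystallization.Theorems.ExcessDecayLiouville

open scoped BigOperators Topology InnerProductSpace RealInnerProductSpace Classical
open Literature.MathematicalPhysics.StatisticalMechanics
open Summit.AtomisticToContinuum.Crystallization.Theorems.PhononStabilityNegative

-- Local notation: the force-constant map `K(e)w = h(|e|²)w + 2⟪e,w⟫h′(|e|²)e`.
local notation3 "𝕂[" e "] " w:max =>
  (-((‖e‖ ^ 2)⁻¹) ^ 7 + ((‖e‖ ^ 2)⁻¹) ^ 4) • w + (2 * ⟪e, w⟫ * (7 * ((‖e‖ ^ 2)⁻¹) ^ 8 - 4 * ((‖e‖ ^ 2)⁻¹) ^ 5)) • e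
set_option quotPrecheck false in
-- Local notation: ball indicator.
local notation "𝟙ᵇ[" x ", " c ", " R "]" => (if dist (x : EuclideanSpace ℝ (Fin 3)) c ≤ R then (1 : ℝ) else 0)

section

variable {t : Fin 2 → (EuclideanSpace ℝ (Fin 3))} {A : (EuclideanSpace ℝ (Fin 3)) →L[ℝ] (EuclideanSpace ℝ (Fin 3))}

set_option quotPrecheck false in
-- Local notation: the operator row `(L v)(p)`.
local notation "𝕃" v:max " @ " p:max =>
  tsum (fun q : Sites₀ t A => (if ((p : Sites₀ t A) : EuclideanSpace ℝ (Fin 3)) ≠ q then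
    𝕂[((p : Sites₀ t A) : EuclideanSpace ℝ (Fin 3)) - q] (v ((p : Sites₀ t A) : EuclideanSpace ℝ (Fin 3)) - v q) else 0))

/-! ## The work of flux rows -/

/-- **The work of flux rows against `η² f`.**  If the rows of `f` at the sites of `SR ∩ B_{ρ₁}(c₀)` are
`(L f)(p) = φ p + Σ_{q ∈ SR∖p} Φ p q` with `Φ` antisymmetric on `SR`, and `η` vanishes off `SR ∩ B_{ρ₁}(c₀)`, then
`Σ'_p η_p² ⟪(L f)(p), f p⟫ ≤ Σ_{p∈SR} η_p² ‖φ p‖ ‖f p‖ + ½ Σ_{p∈SR} Σ_{q∈SR∖p} ‖Φ p q‖ ‖η_p² f p − η_q² f q‖`.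
[folklore] -/
theorem work_flux_le {f : (EuclideanSpace ℝ (Fin 3)) → (EuclideanSpace ℝ (Fin 3))} (η : (EuclideanSpace ℝ (Fin 3)) → ℝ)
    (SR : Finset (EuclideanSpace ℝ (Fin 3))) (hSRS : ∀ x ∈ SR, x ∈ Sites₀ t A)
    {c₀ : EuclideanSpace ℝ (Fin 3)} {ρ₁ : ℝ} (hηT : ∀ x, η x ≠ 0 → x ∈ SR ∧ dist x c₀ ≤ ρ₁)
    (φ : (EuclideanSpace ℝ (Fin 3)) → (EuclideanSpace ℝ (Fin 3)))
    (Φ : (EuclideanSpace ℝ (Fin 3)) → (EuclideanSpace ℝ (Fin 3)) → (EuclideanSpace ℝ (Fin 3)))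
    (hrow : ∀ p : Sites₀ t A, (p : EuclideanSpace ℝ (Fin 3)) ∈ SR → dist (p : EuclideanSpace ℝ (Fin 3)) c₀ ≤ ρ₁ →
      𝕃 f @ p = φ p + ∑ q ∈ SR.erase p, Φ p q)
    (hanti : ∀ p ∈ SR, ∀ q ∈ SR, Φ q p = -Φ p q) :
    (∑' p : Sites₀ t A, (η p) ^ 2 * ⟪𝕃 f @ p, f p⟫) ≤
      ∑ p ∈ SR, (η p) ^ 2 * (‖φ p‖ * ‖f p‖) +
        (1 / 2) * ∑ p ∈ SR, ∑ q ∈ SR.erase p, ‖Φ p q‖ * ‖(η p) ^ 2 • f p - (η q) ^ 2 • f q‖ := by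
  classical
  set T : Finset (Sites₀ t A) := SR.subtype (· ∈ Sites₀ t A) with hT
  have hmemT : ∀ p : Sites₀ t A, p ∈ T ↔ (p : EuclideanSpace ℝ (Fin 3)) ∈ SR := fun p => by
    rw [hT, Finset.mem_subtype]
  -- the work as a finite sum over `T`
  have h1 : (∑' p : Sites₀ t A, (η p) ^ 2 * ⟪𝕃 f @ p, f p⟫) = ∑ p ∈ T, (η p) ^ 2 * ⟪𝕃 f @ p, f p⟫ := by
    refine tsum_eq_sum fun p hp => ?_
    have : η p = 0 := by
      by_contra h; exact hp ((hmemT p).2 (hηT p h).1)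
    rw [this]; ring
  -- row by row: `η_p² ⟪L f, f⟫ = ⟪φ p + Σ Φ, η_p² f p⟫`
  have h2 : ∑ p ∈ T, (η p) ^ 2 * ⟪𝕃 f @ p, f p⟫ =
      ∑ p ∈ T, ⟪φ p + ∑ q ∈ SR.erase p, Φ p q, (η p) ^ 2 • f (p : EuclideanSpace ℝ (Fin 3))⟫ := by
    refine Finset.sum_congr rfl fun p hp => ?_
    by_cases hη : η p = 0
    · rw [hη]; simp
    · rw [← hrow p ((hmemT p).1 hp) (hηT p hη).2, real_inner_smul_right, real_inner_comm]
  have h3 : ∑ p ∈ T, ⟪φ p + ∑ q ∈ SR.erase p, Φ p q, (η p) ^ 2 • f (p : EuclideanSpace ℝ (Fin 3))⟫ =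
      ∑ x ∈ SR, ⟪φ x + ∑ q ∈ SR.erase x, Φ x q, (η x) ^ 2 • f x⟫ := by
    rw [hT, Finset.sum_subtype_of_mem (f := fun x => ⟪φ x + ∑ q ∈ SR.erase x, Φ x q, (η x) ^ 2 • f x⟫) hSRS]
  rw [h1, h2, h3]
  have h4 : ∑ x ∈ SR, ⟪φ x + ∑ q ∈ SR.erase x, Φ x q, (η x) ^ 2 • f x⟫ =
      ∑ x ∈ SR, ⟪φ x, (η x) ^ 2 • f x⟫ + ∑ x ∈ SR, ∑ q ∈ SR.erase x, ⟪Φ x q, (η x) ^ 2 • f x⟫ := by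
    rw [← Finset.sum_add_distrib]
    refine Finset.sum_congr rfl fun x _ => ?_
    rw [inner_add_left, sum_inner]
  rw [h4, flux_symmetrize SR Φ (fun x => (η x) ^ 2 • f x) hanti]
  refine add_le_add (Finset.sum_le_sum fun x _ => ?_)
    (mul_le_mul_of_nonneg_left (Finset.sum_le_sum fun p _ => Finset.sum_le_sum fun q _ => real_inner_le_norm _ _)
      (by norm_num))
  rw [real_inner_smul_right]
  refine mul_le_mul_of_nonneg_left (real_inner_le_norm _ _) (sq_nonneg _)

/-! ## The strain form of `η² f` versus that of `η f` -/

/-- One pair: `‖η_p² f p − η_q² f q‖² ≤ 2 ‖η_p f p − η_q f q‖² + 2 (η_p − η_q)² ‖f q‖² 𝟙[η_q ≠ 0]` (for `|η| ≤ 1`).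
[folklore] -/
theorem sqCutoff_pair_le {f : (EuclideanSpace ℝ (Fin 3)) → (EuclideanSpace ℝ (Fin 3))} {η : (EuclideanSpace ℝ (Fin 3)) → ℝ}
    (hη : ∀ x, |η x| ≤ 1) (p q : EuclideanSpace ℝ (Fin 3)) :
    ‖(η p) ^ 2 • f p - (η q) ^ 2 • f q‖ ^ 2 ≤
      2 * ‖η p • f p - η q • f q‖ ^ 2 + 2 * ((η p - η q) ^ 2 * ‖η q • f q‖ ^ 2) := by
  have e : (η p) ^ 2 • f p - (η q) ^ 2 • f q = η p • (η p • f p - η q • f q) + (η p - η q) • (η q • f q) := by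
    rw [smul_sub, sub_smul, smul_smul, smul_smul, smul_smul, sq, sq]; abel
  rw [e]
  have h1 : ‖η p • (η p • f p - η q • f q)‖ ≤ ‖η p • f p - η q • f q‖ := by
    rw [norm_smul, Real.norm_eq_abs]
    calc |η p| * ‖η p • f p - η q • f q‖ ≤ 1 * ‖η p • f p - η q • f q‖ :=
          mul_le_mul_of_nonneg_right (hη p) (norm_nonneg _)
      _ = _ := one_mul _
  have h2 : ‖(η p - η q) • (η q • f q)‖ ^ 2 = (η p - η q) ^ 2 * ‖η q • f q‖ ^ 2 := by
    rw [norm_smul, mul_pow, Real.norm_eq_abs, sq_abs]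
  calc ‖η p • (η p • f p - η q • f q) + (η p - η q) • (η q • f q)‖ ^ 2
      ≤ (‖η p • (η p • f p - η q • f q)‖ + ‖(η p - η q) • (η q • f q)‖) ^ 2 :=
        pow_le_pow_left₀ (norm_nonneg _) (norm_add_le _ _) 2
    _ ≤ 2 * ‖η p • (η p • f p - η q • f q)‖ ^ 2 + 2 * ‖(η p - η q) • (η q • f q)‖ ^ 2 := by
        nlinarith [sq_nonneg (‖η p • (η p • f p - η q • f q)‖ - ‖(η p - η q) • (η q • f q)‖)]
    _ ≤ 2 * ‖η p • f p - η q • f q‖ ^ 2 + 2 * ((η p - η q) ^ 2 * ‖η q • f q‖ ^ 2) := by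
        rw [h2]; gcongr

variable (hA : Adm₀ A) (hI : Inner₀ t A)
include hA hI

/-- **The strain form of `η² f`**: for a cut-off with `0 ≤ η ≤ 1`, `|η p − η q| ≤ ‖p − q‖/d`, vanishing off
`B_R(c₀)`, `nnForm(η² f) ≤ 2 nnForm(η f) + (2 (11/10)⁸/d²) C₆ 𝐌[f, R]` (`C₆ = 1024/((23/25)³(23/25)³)`). [folklore] -/
theorem nnForm_sqCutoff_le {f : (EuclideanSpace ℝ (Fin 3)) → (EuclideanSpace ℝ (Fin 3))} (hf : (Function.support f).Finite)
    {η : (EuclideanSpace ℝ (Fin 3)) → ℝ} (hη0 : ∀ x, 0 ≤ η x) (hη1 : ∀ x, η x ≤ 1)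
    {c₀ : EuclideanSpace ℝ (Fin 3)} {R d : ℝ} (hd : 0 < d) (hηR : ∀ x, R < dist x c₀ → η x = 0)
    (hlip : ∀ p q : Sites₀ t A, |η p - η q| ≤ ‖(p : (EuclideanSpace ℝ (Fin 3))) - q‖ / d) :
    nnForm t A (fun x => (η x) ^ 2 • f x) ≤
      2 * nnForm t A (fun x => η x • f x) +
        2 * ((11 / 10 : ℝ) ^ 8 / d ^ 2) * ((1024 / ((23 / 25 : ℝ) ^ 3 * (23 / 25 : ℝ) ^ 3)) *
          ∑' q : Sites₀ t A, ‖f q‖ ^ 2 * 𝟙ᵇ[q, c₀, R + 0]) := by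
  have hηabs : ∀ x, |η x| ≤ 1 := fun x => abs_le.2 ⟨by linarith [hη0 x], hη1 x⟩
  have hW : (Function.support fun x => (η x) ^ 2 • f x).Finite :=
    hf.subset fun x hx => by
      rw [Function.mem_support] at hx ⊢; intro h; exact hx (by rw [h, smul_zero])
  have hV : (Function.support fun x => η x • f x).Finite :=
    hf.subset fun x hx => by
      rw [Function.mem_support] at hx ⊢; intro h; exact hx (by rw [h, smul_zero])
  have hrowsW := summable_nnRows hA hI hW
  have hrowsV := summable_nnRows hA hI hV
  have hWn := summable_nearWeight hA hI hf c₀ R 0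
  have hrowN : ∀ p : Sites₀ t A, Summable (fun q : Sites₀ t A => (if (p : (EuclideanSpace ℝ (Fin 3))) ≠ q then
      (dist (p : (EuclideanSpace ℝ (Fin 3))) q)⁻¹ ^ 6 * (‖f q‖ ^ 2 * 𝟙ᵇ[q, c₀, R + 0]) else 0)) := fun p => hWn.prod_factor p
  have hprodN : Summable (fun p : Sites₀ t A => ∑' q : Sites₀ t A, (if (p : (EuclideanSpace ℝ (Fin 3))) ≠ q then
      (dist (p : (EuclideanSpace ℝ (Fin 3))) q)⁻¹ ^ 6 * (‖f q‖ ^ 2 * 𝟙ᵇ[q, c₀, R + 0]) else 0)) := hWn.prod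
  -- termwise bound of the rows
  have hterm : ∀ p q : Sites₀ t A,
      (if dist (p : EuclideanSpace ℝ (Fin 3)) q ≤ 11 / 10 then ‖(η p) ^ 2 • f p - (η q) ^ 2 • f q‖ ^ 2 else 0) ≤
        2 * (if dist (p : EuclideanSpace ℝ (Fin 3)) q ≤ 11 / 10 then ‖η p • f p - η q • f q‖ ^ 2 else 0) +
        2 * ((11 / 10 : ℝ) ^ 8 / d ^ 2) * (if (p : (EuclideanSpace ℝ (Fin 3))) ≠ q then
          (dist (p : (EuclideanSpace ℝ (Fin 3))) q)⁻¹ ^ 6 * (‖f q‖ ^ 2 * 𝟙ᵇ[q, c₀, R + 0]) else 0) := by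
    intro p q
    by_cases hn : dist (p : EuclideanSpace ℝ (Fin 3)) q ≤ 11 / 10
    · rw [if_pos hn, if_pos hn]
      refine (sqCutoff_pair_le hηabs p q).trans (add_le_add le_rfl ?_)
      by_cases hpq : (p : EuclideanSpace ℝ (Fin 3)) = q
      · rw [hpq, sub_self]; simp
      · rw [if_pos hpq]
        have hdq : 23 / 25 ≤ dist (p : EuclideanSpace ℝ (Fin 3)) q := dist_sites_ge hA hI p.2 q.2 hpq
        have hd0 : 0 < dist (p : EuclideanSpace ℝ (Fin 3)) q := by linarith
        -- (η p − η q)² ≤ (11/10)²/d²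
        have hl := hlip p q
        rw [← dist_eq_norm] at hl
        have hl2 : (η p - η q) ^ 2 ≤ (11 / 10) ^ 2 / d ^ 2 := by
          have h1 : |η p - η q| ≤ (11 / 10) / d := hl.trans (div_le_div_of_nonneg_right hn hd.le)
          have := pow_le_pow_left₀ (abs_nonneg _) h1 2
          rwa [sq_abs, div_pow] at this
        -- ‖η q • f q‖² ≤ ‖f q‖² 𝟙[q ∈ B_R]
        have hfq : ‖η q • f q‖ ^ 2 ≤ ‖f q‖ ^ 2 * 𝟙ᵇ[q, c₀, R + 0] := by
          by_cases hq : dist (q : EuclideanSpace ℝ (Fin 3)) c₀ ≤ R + 0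
          · rw [if_pos hq, mul_one, norm_smul, mul_pow, Real.norm_eq_abs, sq_abs]
            calc (η q) ^ 2 * ‖f q‖ ^ 2 ≤ 1 * ‖f q‖ ^ 2 := by
                  refine mul_le_mul_of_nonneg_right ?_ (sq_nonneg _)
                  have := hη0 q; have := hη1 q; nlinarith
              _ = ‖f q‖ ^ 2 := one_mul _
          · rw [hηR q (by linarith), zero_smul, norm_zero, if_neg hq]; simp
        -- 1 ≤ (11/10)⁶ d(p,q)⁻⁶
        have hinv : (1 : ℝ) ≤ (11 / 10 : ℝ) ^ 6 * (dist (p : EuclideanSpace ℝ (Fin 3)) q)⁻¹ ^ 6 := by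
          rw [← mul_pow, ← div_eq_mul_inv, one_le_pow_iff_of_nonneg (by positivity) (by norm_num)]
          rw [le_div_iff₀ hd0]; linarith
        have hf0 : 0 ≤ ‖f q‖ ^ 2 * 𝟙ᵇ[q, c₀, R + 0] := by positivity
        calc 2 * ((η p - η q) ^ 2 * ‖η q • f q‖ ^ 2)
            ≤ 2 * (((11 / 10) ^ 2 / d ^ 2) * (‖f q‖ ^ 2 * 𝟙ᵇ[q, c₀, R + 0])) := by gcongr
          _ = 2 * ((11 / 10) ^ 2 / d ^ 2) * 1 * (‖f q‖ ^ 2 * 𝟙ᵇ[q, c₀, R + 0]) := by ring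
          _ ≤ 2 * ((11 / 10) ^ 2 / d ^ 2) * ((11 / 10 : ℝ) ^ 6 * (dist (p : EuclideanSpace ℝ (Fin 3)) q)⁻¹ ^ 6) *
              (‖f q‖ ^ 2 * 𝟙ᵇ[q, c₀, R + 0]) := by gcongr
          _ = 2 * ((11 / 10 : ℝ) ^ 8 / d ^ 2) *
              ((dist (p : EuclideanSpace ℝ (Fin 3)) q)⁻¹ ^ 6 * (‖f q‖ ^ 2 * 𝟙ᵇ[q, c₀, R + 0])) := by ring
    · rw [if_neg hn, if_neg hn, mul_zero, zero_add]
      positivity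
  -- summing
  unfold nnForm
  have hrow : ∀ p : Sites₀ t A,
      (∑' q : Sites₀ t A, (if dist (p : EuclideanSpace ℝ (Fin 3)) q ≤ 11 / 10 then ‖(η p) ^ 2 • f p - (η q) ^ 2 • f q‖ ^ 2 else 0)) ≤
        2 * (∑' q : Sites₀ t A, (if dist (p : EuclideanSpace ℝ (Fin 3)) q ≤ 11 / 10 then ‖η p • f p - η q • f q‖ ^ 2 else 0)) +
        2 * ((11 / 10 : ℝ) ^ 8 / d ^ 2) * (∑' q : Sites₀ t A, (if (p : (EuclideanSpace ℝ (Fin 3))) ≠ q then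
          (dist (p : (EuclideanSpace ℝ (Fin 3))) q)⁻¹ ^ 6 * (‖f q‖ ^ 2 * 𝟙ᵇ[q, c₀, R + 0]) else 0)) := by
    intro p
    have hVr := summable_nnRow hA hI (fun x => η x • f x) p
    have hWr := summable_nnRow hA hI (fun x => (η x) ^ 2 • f x) p
    rw [← tsum_mul_left, ← tsum_mul_left, ← Summable.tsum_add (hVr.mul_left _) ((hrowN p).mul_left _)]
    exact Summable.tsum_le_tsum (hterm p) hWr ((hVr.mul_left _).add ((hrowN p).mul_left _))
  calc _ ≤ ∑' p : Sites₀ t A, (2 * (∑' q : Sites₀ t A, (if dist (p : EuclideanSpace ℝ (Fin 3)) q ≤ 11 / 10 then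
          ‖η p • f p - η q • f q‖ ^ 2 else 0)) +
        2 * ((11 / 10 : ℝ) ^ 8 / d ^ 2) * (∑' q : Sites₀ t A, (if (p : (EuclideanSpace ℝ (Fin 3))) ≠ q then
          (dist (p : (EuclideanSpace ℝ (Fin 3))) q)⁻¹ ^ 6 * (‖f q‖ ^ 2 * 𝟙ᵇ[q, c₀, R + 0]) else 0))) :=
        Summable.tsum_le_tsum hrow hrowsW ((hrowsV.mul_left _).add (hprodN.mul_left _))
    _ = 2 * (∑' p : Sites₀ t A, ∑' q : Sites₀ t A, (if dist (p : EuclideanSpace ℝ (Fin 3)) q ≤ 11 / 10 then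
          ‖η p • f p - η q • f q‖ ^ 2 else 0)) +
        2 * ((11 / 10 : ℝ) ^ 8 / d ^ 2) * (∑' p : Sites₀ t A, ∑' q : Sites₀ t A, (if (p : (EuclideanSpace ℝ (Fin 3))) ≠ q then
          (dist (p : (EuclideanSpace ℝ (Fin 3))) q)⁻¹ ^ 6 * (‖f q‖ ^ 2 * 𝟙ᵇ[q, c₀, R + 0]) else 0)) := by
        rw [(hrowsV.mul_left _).tsum_add (hprodN.mul_left _), tsum_mul_left, tsum_mul_left]
    _ ≤ _ := by
        gcongr
        exact tsum_tsum_nearWeight_le hA hI hf c₀ R 0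

end

end Summit.AtomisticToContinuum.Crystallization.Theorems.ExcessDecayLiouville

end
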